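import Summits.BirchSwinnertonDyer.BirchSwinnertonDyer.Theorems.ManinLocalTwoThreeAtkinLehnerEtaFortyFive
import Summits.BirchSwinnertonDyer.BirchSwinnertonDyer.Theorems.ManinLocalTwoThreeAtkinLehnerCuspFiftySix
import HarnessLib

/-!
# The cusp `1/9` of `X₀(45)` through `W₅`: orbit decomposition `A = g·A₀·Tʲ`, transport of `q`-limits through `τ ↦ (σ−1)/5`,
# and the Ligozat bounds of `T`, `S` at the other cusps

Cell bsd-f2-manin, route `ManinLocalTwoThree` (crux C3 `ManinPrimeToThreeAtNine`, stmt-22968: `3² ∣ 45`), prover seat p2 gen 28; the level-`45`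
copy of `…AtkinLehnerCuspFiftySix` (whose `Tʲ`-transport lemmas are level-free and reused).  The fibre of `X₀(45) → 45a1` over `O` is `{∞, 1/9}`
(the poles of `T = η₁η₅/(η₉η₄₅) = x − 2` and `S = η₃²η₁₅²/(η₉²η₄₅²)`), and `1/9 = W₅∞`.

* §1 ORBIT: `A ∈ SL₂(ℤ) ∖ Γ₀(45)` with `9 ∣ c(A)` factors as `A = g·A₀·Tʲ`, `g ∈ Γ₀(45)`, `A₀ = (1 0; 9 1)` (`5 ∤ c/9`; `j ≡ (c/9 − d)(c/9)⁻¹ (mod 5)`);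
* §2 TRANSPORT through `β⁻¹ : σ ↦ (σ−1)/5` (zero / bounded / `Tendsto` / chain rule `((G∘β⁻¹)∘ofComplex)′ = G′∘β⁻¹/5`), and «zero / bounded at the
  whole class of `1/9`» from the lower-unipotent representative;
* §3 LIGOZAT at the other cusps: for `9 ∤ c(A)` (classes `1, 1/3, 1/5, 1/15`, orders of `T`: `2,0,2,0`, of `S`: `1,1,1,1`) `T∘A`, `S∘A` are bounded at
  `i∞`, and `T`, `S` are `Γ₀(45)`-invariant (Newman, weight `0`).

No definition, no named fact, no sorry; nothing here proves C3, Manin's conjecture or BSD. [cite: DiamondShurman2005, §3.8] [cite: Ligozat1975, Ch. 3]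
[cite: AtkinLehner1970, Lemma 7]
-/

set_option autoImplicit false
-- lint-debt: the directory name repeats the summit name (sibling precedent `ManinLocalTwoThreeAtkinLehnerCuspFiftySix.lean`)
set_option linter.dupNamespace false

noncomputable section

open Complex Filter Topology Set Asymptotics
open UpperHalfPlane hiding I
open scoped Real Topology Manifold MatrixGroups ModularForm
open ModularForm CongruenceSubgroup
open Literature.NumberTheory.ModularForms
open Literature.NumberTheory.EllipticCurves Literature.NumberTheory.EllipticCurves.ModularForms

namespace Summit.BirchSwinnertonDyer.BirchSwinnertonDyer.Theorems.ManinLocalTwoThree.AtkinLehnerCuspFortyFive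

open CuspToolkit AtkinLehnerEtaFortyFive
open AtkinLehnerCuspFiftySix (tendsto_T_zpow_smul slash_T_zpow_apply isZeroAtImInfty_slash_mul_T_zpow isBoundedAtImInfty_slash_mul_T_zpow)

/-! ## §1 The orbit of the cusp `1/9`: `A = g·A₀·Tʲ` -/

/-- `5 ∤ c/9` when `9 ∣ c` and `A ∉ Γ₀(45)`. [folklore] -/
theorem not_five_dvd_of_not_mem {A : SL(2, ℤ)} {c' : ℤ} (hc : A 1 0 = 9 * c') (hA : A ∉ Gamma0 45) : ¬ (5 : ℤ) ∣ c' := by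
  rintro ⟨m, hm⟩
  apply hA
  rw [Gamma0_mem]
  refine (ZMod.intCast_zmod_eq_zero_iff_dvd _ 45).mpr ⟨m, ?_⟩
  rw [hc, hm]; ring

/-- **`A = g·A₀·Tʲ`** for `A ∈ SL₂(ℤ) ∖ Γ₀(45)` with `9 ∣ c(A)`: `g ∈ Γ₀(45)`, `A₀ = (1 0; 9 1)`, `j ∈ ℤ` (the cusp `A∞` is the cusp `1/9` of `X₀(45)`,
of width `5`). [cite: DiamondShurman2005, §3.8] -/
theorem exists_decomp_cusp_ninth {A : SL(2, ℤ)} (h9 : (9 : ℤ) ∣ A 1 0) (hA : A ∉ Gamma0 45) :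
    ∃ (g A₀ : SL(2, ℤ)) (j : ℤ), g ∈ Gamma0 45 ∧ A₀ 0 0 = 1 ∧ A₀ 0 1 = 0 ∧ A₀ 1 0 = 9 ∧ A₀ 1 1 = 1 ∧
      A = g * A₀ * ModularGroup.T ^ j := by
  obtain ⟨c', hc'⟩ := h9
  have h5 := not_five_dvd_of_not_mem hc' hA
  have hcop : IsCoprime c' 5 := by
    rw [Int.isCoprime_iff_gcd_eq_one]
    rcases (Nat.dvd_prime (by norm_num : Nat.Prime 5)).mp (Int.gcd_dvd_natAbs_right c' 5 |>.trans (by norm_num)) with h | h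
    · exact h
    · exfalso; apply h5
      have := Int.gcd_dvd_left c' 5
      rw [h] at this
      exact_mod_cast this
  obtain ⟨u, v, huv⟩ := hcop
  set d : ℤ := A 1 1 with hd
  set j : ℤ := u * (c' - d) with hj
  let A₀ : SL(2, ℤ) := ⟨!![1, 0; 9, 1], by norm_num [Matrix.det_fin_two_of]⟩
  let B : SL(2, ℤ) := ⟨!![1, 0; -9, 1], by norm_num [Matrix.det_fin_two_of]⟩
  have hBA : B * A₀ = 1 := by
    ext i j
    fin_cases i <;> fin_cases j <;> simp [A₀, B, Matrix.mul_apply, Fin.sum_univ_two]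
  refine ⟨A * ModularGroup.T ^ (-j) * B, A₀, j, ?_, rfl, rfl, rfl, rfl, ?_⟩
  · rw [Gamma0_mem]
    have hentry : ((A * ModularGroup.T ^ (-j) * B : SL(2, ℤ)) : Matrix (Fin 2) (Fin 2) ℤ) 1 0
        = A 1 0 - 9 * (A 1 0 * (-j) + A 1 1) := by
      simp [B, Matrix.mul_apply, Fin.sum_univ_two, ModularGroup.coe_T_zpow]
      ring
    rw [show ((A * ModularGroup.T ^ (-j) * B : SL(2, ℤ)) 1 0 : ℤ) = A 1 0 - 9 * (A 1 0 * (-j) + A 1 1) from hentry]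
    refine (ZMod.intCast_zmod_eq_zero_iff_dvd _ 45).mpr ⟨(c' - d) * (2 - 9 * v), ?_⟩
    rw [hc', ← hd, hj]
    linear_combination (81 * (c' - d)) * huv
  · rw [mul_assoc (A * ModularGroup.T ^ (-j)), hBA, mul_one, mul_assoc, ← zpow_add, neg_add_cancel, zpow_zero, mul_one]

/-! ## §2 Transport of `q`-limits through `β⁻¹ : σ ↦ (σ − 1)/5` -/

/-- `G((σ−1)/5) → 0` at `i∞` if `G → 0` at `i∞`. [folklore] -/
theorem isZeroAtImInfty_comp_affPt {G : ℍ → ℂ} (h : IsZeroAtImInfty G) :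
    IsZeroAtImInfty (fun σ : ℍ ↦ G (affPt 1 (-1) 5 one_pos (by norm_num) σ)) :=
  h.comp (tendsto_affPt_atImInfty 1 (-1) 5 one_pos (by norm_num))

/-- `G((σ−1)/5)` is bounded at `i∞` if `G` is. [folklore] -/
theorem isBoundedAtImInfty_comp_affPt {G : ℍ → ℂ} (h : IsBoundedAtImInfty G) :
    IsBoundedAtImInfty (fun σ : ℍ ↦ G (affPt 1 (-1) 5 one_pos (by norm_num) σ)) :=
  h.comp_tendsto (tendsto_affPt_atImInfty 1 (-1) 5 one_pos (by norm_num))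

/-- A `Tendsto`-transport: `H((σ−1)/5) → L` at `i∞` if `H → L` at `i∞`. [folklore] -/
theorem tendsto_comp_affPt {H : ℍ → ℂ} {L : ℂ} (h : Tendsto H atImInfty (𝓝 L)) :
    Tendsto (fun σ : ℍ ↦ H (affPt 1 (-1) 5 one_pos (by norm_num) σ)) atImInfty (𝓝 L) :=
  h.comp (tendsto_affPt_atImInfty 1 (-1) 5 one_pos (by norm_num))

/-- **Chain rule through `β⁻¹`**: `((G∘β⁻¹)∘ofComplex)′(σ) = G′((σ−1)/5)/5` for holomorphic `G` on `ℍ`. [folklore] -/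
theorem deriv_comp_affPt {G : ℍ → ℂ} (hG : MDifferentiable 𝓘(ℂ) 𝓘(ℂ) G) (σ : ℍ) :
    deriv ((fun s : ℍ ↦ G (affPt 1 (-1) 5 one_pos (by norm_num) s)) ∘ ofComplex) σ
      = (1 / 5 : ℂ) * deriv (G ∘ ofComplex) ((affPt 1 (-1) 5 one_pos (by norm_num) σ : ℍ) : ℂ) := by
  have hdiff := UpperHalfPlane.mdifferentiable_iff.mp hG
  have him : ∀ z : ℂ, 0 < z.im → 0 < ((z - 1) / 5).im := fun z hz ↦ by
    rw [show (z - 1) / 5 = (z - 1) * ((5 : ℝ) : ℂ)⁻¹ by push_cast; ring, Complex.mul_im]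
    simp
    positivity
  have hpt : ∀ z : ℂ, ∀ hz : 0 < z.im, ((affPt 1 (-1) 5 one_pos (by norm_num) (ofComplex z) : ℍ) : ℂ) = (z - 1) / 5 := fun z hz ↦ by
    rw [coe_affPt, ofComplex_apply_of_im_pos hz]
    push_cast
    ring
  have heq : ((fun s : ℍ ↦ G (affPt 1 (-1) 5 one_pos (by norm_num) s)) ∘ ofComplex) =ᶠ[𝓝 (σ : ℂ)]
      ((G ∘ ofComplex) ∘ fun z : ℂ ↦ (z - 1) / 5) := by
    filter_upwards [isOpen_upperHalfPlaneSet.mem_nhds σ.im_pos] with z hz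
    simp only [Function.comp_apply]
    congr 1
    ext1
    rw [hpt z hz, ofComplex_apply_of_im_pos (him z hz)]
  rw [heq.deriv_eq]
  have hσ' : 0 < (((σ : ℂ) - 1) / 5).im := him _ σ.im_pos
  have h1 : HasDerivAt (G ∘ ofComplex) (deriv (G ∘ ofComplex) (((σ : ℂ) - 1) / 5)) (((σ : ℂ) - 1) / 5) :=
    ((hdiff _ hσ').differentiableAt (isOpen_upperHalfPlaneSet.mem_nhds hσ')).hasDerivAt
  have h2 : HasDerivAt (fun z : ℂ ↦ (z - 1) / 5) (1 / 5) (σ : ℂ) := by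
    simpa using ((hasDerivAt_id (σ : ℂ)).sub_const 1).div_const 5
  rw [(h1.comp (σ : ℂ) h2).deriv, show ((affPt 1 (-1) 5 one_pos (by norm_num) σ : ℍ) : ℂ) = ((σ : ℂ) - 1) / 5 by
    rw [coe_affPt]; push_cast; ring]
  ring

/-- **Zero at the whole class of the cusp `1/9`**: if `F` is `Γ₀(45)`-invariant in weight `k` and `F|ₖA₀ → 0` at `i∞` for every
`A₀ = (1 0; 9 1)` (given by its entries), then `F|ₖA → 0` for every `A ∉ Γ₀(45)` with `9 ∣ c(A)`. [cite: DiamondShurman2005, §3.8] -/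
theorem isZeroAtImInfty_slash_of_cusp_ninth (F : ℍ → ℂ) (k : ℤ) (hF : ∀ γ : SL(2, ℤ), γ ∈ Gamma0 45 → F ∣[k] γ = F)
    (hA₀ : ∀ A₀ : SL(2, ℤ), A₀ 0 0 = 1 → A₀ 0 1 = 0 → A₀ 1 0 = 9 → A₀ 1 1 = 1 → IsZeroAtImInfty (F ∣[k] A₀))
    {A : SL(2, ℤ)} (h9 : (9 : ℤ) ∣ A 1 0) (hA : A ∉ Gamma0 45) : IsZeroAtImInfty (F ∣[k] A) := by
  obtain ⟨g, A₀, j, hg, h00, h01, h10, h11, rfl⟩ := exists_decomp_cusp_ninth h9 hA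
  rw [SlashAction.slash_mul, SlashAction.slash_mul, hF g hg, ← SlashAction.slash_mul]
  exact isZeroAtImInfty_slash_mul_T_zpow F k A₀ j (hA₀ A₀ h00 h01 h10 h11)

/-- **Bounded at the whole class of the cusp `1/9`** (same, with «bounded»). [cite: DiamondShurman2005, §3.8] -/
theorem isBoundedAtImInfty_slash_of_cusp_ninth (F : ℍ → ℂ) (k : ℤ) (hF : ∀ γ : SL(2, ℤ), γ ∈ Gamma0 45 → F ∣[k] γ = F)
    (hA₀ : ∀ A₀ : SL(2, ℤ), A₀ 0 0 = 1 → A₀ 0 1 = 0 → A₀ 1 0 = 9 → A₀ 1 1 = 1 → IsBoundedAtImInfty (F ∣[k] A₀))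
    {A : SL(2, ℤ)} (h9 : (9 : ℤ) ∣ A 1 0) (hA : A ∉ Gamma0 45) : IsBoundedAtImInfty (F ∣[k] A) := by
  obtain ⟨g, A₀, j, hg, h00, h01, h10, h11, rfl⟩ := exists_decomp_cusp_ninth h9 hA
  rw [SlashAction.slash_mul, SlashAction.slash_mul, hF g hg, ← SlashAction.slash_mul]
  exact isBoundedAtImInfty_slash_mul_T_zpow F k A₀ j (hA₀ A₀ h00 h01 h10 h11)

/-! ## §3 `T`, `S` are `Γ₀(45)`-invariant and bounded at the cusps `a/c` with `9 ∤ c` -/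

/-- Newman's conditions for `T` in weight `0` at level `45`. [folklore] -/
theorem newmanCond_T : NewmanCond 45 (expFn [(1, 1), (5, 1), (9, -1), (45, -1)]) 0 :=
  ⟨by decide, by decide, by decide, ⟨45, by decide⟩⟩

/-- Newman's conditions for `S` in weight `0` at level `45`. [folklore] -/
theorem newmanCond_S : NewmanCond 45 (expFn [(3, 2), (9, -2), (15, 2), (45, -2)]) 0 :=
  ⟨by decide, by decide, by decide, ⟨18225, by decide⟩⟩

/-- `T(γτ) = T(τ)` for `γ ∈ Γ₀(45)`. [folklore] -/
theorem T_smul (γ : SL(2, ℤ)) (hγ : γ ∈ Gamma0 45) (τ : ℍ) :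
    etaQuotient 45 (expFn [(1, 1), (5, 1), (9, -1), (45, -1)]) (γ • τ) = etaQuotient 45 (expFn [(1, 1), (5, 1), (9, -1), (45, -1)]) τ := by
  have h := etaQuotient_smul_of_mem_Gamma0 45 (by norm_num) _ 0 ⟨0, by simp⟩ newmanCond_T hγ τ
  rwa [zpow_zero, one_mul] at h

/-- `S(γτ) = S(τ)` for `γ ∈ Γ₀(45)`. [folklore] -/
theorem S_smul (γ : SL(2, ℤ)) (hγ : γ ∈ Gamma0 45) (τ : ℍ) :
    etaQuotient 45 (expFn [(3, 2), (9, -2), (15, 2), (45, -2)]) (γ • τ) = etaQuotient 45 (expFn [(3, 2), (9, -2), (15, 2), (45, -2)]) τ := by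
  have h := etaQuotient_smul_of_mem_Gamma0 45 (by norm_num) _ 0 ⟨0, by simp⟩ newmanCond_S hγ τ
  rwa [zpow_zero, one_mul] at h

/-- Ligozat's order at level `45` is `≥ 0` at every `c` with `9 ∤ c`, given the values at the divisors `t` with `9 ∤ t`. [cite: Ligozat1975, Ch. 3] -/
theorem cuspOrder24_nonneg_of_not_dvd9 (r : ℕ → ℤ)
    (h : ∀ t ∈ Nat.divisors 45, ¬ 9 ∣ t → 0 ≤ cuspOrder24 45 r t) {c : ℤ} (hc : ¬ (9 : ℤ) ∣ c) :
    0 ≤ cuspOrder24 45 r c := by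
  rw [cuspOrder24_eq_gcd]
  refine h _ (Nat.mem_divisors.mpr ⟨Nat.gcd_dvd_left _ _, by norm_num⟩) fun hd ↦ hc ?_
  exact Int.natCast_dvd.mpr (hd.trans (Nat.gcd_dvd_right _ _))

/-- **`T∘A` is bounded at `i∞` when `9 ∤ c(A)`** (Ligozat orders `2, 0, 2, 0` at the cusps `1/c`, `c = 1, 3, 5, 15`). [cite: Ligozat1975, Ch. 3] -/
theorem isBoundedAtImInfty_T_smul {A : SL(2, ℤ)} (hA : ¬ (9 : ℤ) ∣ A 1 0) :
    IsBoundedAtImInfty (fun τ : ℍ ↦ etaQuotient 45 (expFn [(1, 1), (5, 1), (9, -1), (45, -1)]) (A • τ)) :=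
  isBoundedAtImInfty_etaQuotient_smul 45 (by norm_num) _ (by decide) A (cuspOrder24_nonneg_of_not_dvd9 _ (by decide) hA)

/-- **`S∘A` is bounded at `i∞` when `9 ∤ c(A)`** (Ligozat orders `1, 1, 1, 1` at the cusps `1/c`, `c = 1, 3, 5, 15`). [cite: Ligozat1975, Ch. 3] -/
theorem isBoundedAtImInfty_S_smul {A : SL(2, ℤ)} (hA : ¬ (9 : ℤ) ∣ A 1 0) :
    IsBoundedAtImInfty (fun τ : ℍ ↦ etaQuotient 45 (expFn [(3, 2), (9, -2), (15, 2), (45, -2)]) (A • τ)) :=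
  isBoundedAtImInfty_etaQuotient_smul 45 (by norm_num) _ (by decide) A (cuspOrder24_nonneg_of_not_dvd9 _ (by decide) hA)

end Summit.BirchSwinnertonDyer.BirchSwinnertonDyer.Theorems.ManinLocalTwoThree.AtkinLehnerCuspFortyFive

end
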